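import Mathlib.Algebra.Field.ZMod
import Mathlib.Algebra.Order.BigOperators.Group.Finset
import Mathlib.Algebra.BigOperators.Ring.Finset
import Mathlib.Algebra.Order.Group.Abs
import Mathlib.Combinatorics.Additive.AP.Three.Defs
import Mathlib.Data.Matrix.Mul
import Mathlib.GroupTheory.Index
import Mathlib.Tactic.Linarith
import Mathlib.Tactic.Positivity
import Mathlib.Tactic.Ring
import Mathlib.Tactic.NormNum
import Mathlib.Tactic.FieldSimp
import Mathlib.Tactic.LinearCombination
import HarnessLib

/-!
# Large free diagonals in tight sets by random hashing (Bürgisser–Clausen–Shokrollahi 1997,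
Thm. 15.39 = Bläser 2013, Thm. 9.6; Coppersmith–Winograd 1990, §6) — restriction variant, proved

Topic `Literature/Computability/AlgebraicComplexity`. This is the combinatorial heart of the laser
method, in the ZEROING-OUT form needed for a rank-only (restriction-only) proof of the
Coppersmith–Winograd bound `ω ≤ log_q(4 R̃(T_cw,q)³/27)` (`CoppersmithWinograd1990.lean`).
Everything here is PROVED and purely combinatorial (no tensors).

## Content

For finite index types `I, J, L`, a "support" `Φ ⊆ I × J × L` and `Δ ⊆ Φ`, we say (inline, no new
definition is introduced) that `Δ` is a *free diagonal in `Φ`* if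
`∀ δ δ' δ'' ∈ Δ, (δ.1, δ'.2.1, δ''.2.2) ∈ Φ → δ = δ' ∧ δ' = δ''`; this is exactly the condition
"`Δ = Φ ∩ (I' × J' × L')` is a diagonal" of BCS Def. 15.29(1)/Lemma 15.38 (zeroing out all blocks
outside `I' = pr₁ Δ`, `J' = pr₂ Δ`, `L' = pr₃ Δ` leaves exactly the blocks of `Δ`, pairwise in
distinct rows, columns and slices).

* `card_le_card_isolated_add_card_collisions`, `isolated_free` — BCS Lemma 15.38 / Bläser 2013
  Lemma 9.4 in the "isolated vertices" form: the elements of `Ψ` sharing no coordinate with another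
  element of `Ψ` form a free diagonal in `Ψ` of size `≥ |Ψ| − #{ordered colliding pairs}`.
* `exists_seed_of_counts` — the probabilistic-method step of BCS Thm. 15.39 (p. 377–379) as a
  counting/averaging statement over an arbitrary finite seed space.
* `card_filter_mul_card_eq_card_of_surjective` — fibres of a surjective homomorphism of finite
  abelian groups are equicardinal (used for the "pairwise/threewise independence" of the hash
  values, BCS p. 378).
* `exists_zeroSum_diagonal` — the Salem–Spencer diagonal replacing BCS Lemma 15.36: for
  `2k ≤ M`, a 3-term-progression-free `t ⊆ {0,…,k-1}` of size `rothNumberNat k` gives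
  `D₁ = D₂ = t`, `D₃ = -2t ⊆ ℤ/M` with `{(x,y,z) ∈ D₁×D₂×D₃ | x+y+z = 0} = {(s,s,-2s)}` a diagonal
  of size `≥ rothNumberNat k` (CW 1990, §6: "Salem–Spencer theorem"; Behrend's bound on
  `rothNumberNat` is Mathlib's `Behrend.roth_lower_bound`).
* `BCS1997_thm1539_free_sub` — the same theorem in RELATIVE form (Le Gall 2014, Lemma A.2): for a
  sub-family `Φ* ⊆ Φ`, a free diagonal `Δ ⊆ Φ*` which is free IN `Φ` with
  `M³ |Δ| ≥ |Φ*| · |D| · (M − 3f)` (needed when only the blocks of one joint type are wanted but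
  freeness must hold among all blocks of the given marginal types — the laser method with values and
  a compatibility penalty, and the asymmetric analyses); `BCS1997_thm1539_free` is the case `Φ* = Φ`.
* `BCS1997_thm1539_free` — **the hashing theorem** (BCS Thm. 15.39 / Bläser Thm. 9.6, with the
  degeneration `D ⊴ Ψ_M` of BCS Lemma 15.36 replaced by an arbitrary diagonal of the form
  `Ψ_M ∩ (D₁ × D₂ × D₃)`, as in Coppersmith–Winograd's original Salem–Spencer argument, CW 1990 §6):
  let `Φ ⊆ I × J × L` be `b`-tight via injective `α, β, γ : · → ℤ^r` (`α i + β j + γ l = 0` on `Φ`,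
  entries bounded by `b`), all fibres of the three projections of `Φ` of size `≤ f`, `M > 2b` prime,
  and `D₁, D₂, D₃ ⊆ ℤ/M` such that `D = {(x,y,z) ∈ D₁×D₂×D₃ | x+y+z = 0}` is a diagonal. Then `Φ`
  contains a free diagonal `Δ` with `M³ |Δ| ≥ |Φ| · |D| · (M − 3f)`.
  (BCS's expectation computation, p. 378–379: `E|Φ_w(d)| = |Φ|/M²`, `E|Π_w(d)| ≤ 3c|Φ|²/(2M³|I|)`.)

## References

* P. Bürgisser, M. Clausen, M. A. Shokrollahi, *Algebraic Complexity Theory*, Springer 1997,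
  Def. 15.29, Lemma 15.38, Thm. 15.39 (pp. 376–379). [BurgisserClausenShokrollahi1997]
* M. Bläser, *Fast Matrix Multiplication*, Theory of Computing Graduate Surveys 5 (2013), Lemma 9.4,
  Thm. 9.6. [Blaser2013]
* D. Coppersmith, S. Winograd, *Matrix multiplication via arithmetic progressions*, J. Symbolic
  Comput. 9 (1990) 251–280, §6. [CoppersmithWinograd1990]
* F. Le Gall, *Powers of tensors and fast matrix multiplication*, ISSAC 2014, arXiv:1401.7714,
  Appendix A.2, Lemma A.2 (the relative form `Λ* ⊆ Λ`). [LeGall2014]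
-/

open scoped BigOperators
open Finset

namespace Literature.Computability.AlgebraicComplexity

universe u

/-! ## Isolated elements form a free diagonal (BCS Lemma 15.38, isolated-vertex form) -/

section Isolated

variable {I J L : Type*} [DecidableEq I] [DecidableEq J] [DecidableEq L]

/-- **BCS Lemma 15.38 / Bläser Lemma 9.4 (isolated-vertex form), size bound**: the elements of `Ψ`
sharing no coordinate with another element of `Ψ` number at least `|Ψ|` minus the number of ordered
pairs of distinct elements of `Ψ` sharing a coordinate. [cite: BurgisserClausenShokrollahi1997, Lemma 15.38] -/
theorem card_le_card_isolated_add_card_collisions (Ψ : Finset (I × J × L)) :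
    Ψ.card ≤ (Ψ.filter fun φ => ∀ ψ ∈ Ψ, ψ ≠ φ → ψ.1 ≠ φ.1 ∧ ψ.2.1 ≠ φ.2.1 ∧ ψ.2.2 ≠ φ.2.2).card +
      ((Ψ ×ˢ Ψ).filter fun p => p.1 ≠ p.2 ∧
        (p.1.1 = p.2.1 ∨ p.1.2.1 = p.2.2.1 ∨ p.1.2.2 = p.2.2.2)).card := by
  rw [← Finset.card_filter_add_card_filter_not
    (p := fun φ => ∀ ψ ∈ Ψ, ψ ≠ φ → ψ.1 ≠ φ.1 ∧ ψ.2.1 ≠ φ.2.1 ∧ ψ.2.2 ≠ φ.2.2)]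
  refine Nat.add_le_add_left ?_ _
  have hsub : (Ψ.filter fun φ => ¬ ∀ ψ ∈ Ψ, ψ ≠ φ → ψ.1 ≠ φ.1 ∧ ψ.2.1 ≠ φ.2.1 ∧ ψ.2.2 ≠ φ.2.2) ⊆
      ((Ψ ×ˢ Ψ).filter fun p => p.1 ≠ p.2 ∧
        (p.1.1 = p.2.1 ∨ p.1.2.1 = p.2.2.1 ∨ p.1.2.2 = p.2.2.2)).image Prod.fst := by
    intro φ hφ
    simp only [Finset.mem_filter, not_forall, exists_prop] at hφ
    obtain ⟨hφΨ, ψ, hψΨ, hne, hcoll⟩ := hφ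
    refine Finset.mem_image.2 ⟨(φ, ψ), Finset.mem_filter.2 ⟨Finset.mem_product.2 ⟨hφΨ, hψΨ⟩,
      hne.symm, ?_⟩, rfl⟩
    by_contra h
    simp only [not_or] at h
    exact hcoll ⟨Ne.symm h.1, Ne.symm h.2.1, Ne.symm h.2.2⟩
  exact (Finset.card_le_card hsub).trans Finset.card_image_le

/-- **BCS Lemma 15.38 / Bläser Lemma 9.4 (isolated-vertex form), diagonal property**: the set of
isolated elements of `Ψ` is a *free diagonal in `Ψ`*: if `(δ.1, δ'.2.1, δ''.2.2) ∈ Ψ` for isolated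
`δ, δ', δ''` then `δ = δ' = δ''` (so zeroing out everything outside `pr₁ Δ × pr₂ Δ × pr₃ Δ` leaves
exactly `Δ`, a diagonal). [cite: BurgisserClausenShokrollahi1997, Lemma 15.38] -/
theorem isolated_free (Ψ : Finset (I × J × L)) {δ δ' δ'' : I × J × L}
    (hδ : δ ∈ Ψ.filter fun φ => ∀ ψ ∈ Ψ, ψ ≠ φ → ψ.1 ≠ φ.1 ∧ ψ.2.1 ≠ φ.2.1 ∧ ψ.2.2 ≠ φ.2.2)
    (hδ' : δ' ∈ Ψ.filter fun φ => ∀ ψ ∈ Ψ, ψ ≠ φ → ψ.1 ≠ φ.1 ∧ ψ.2.1 ≠ φ.2.1 ∧ ψ.2.2 ≠ φ.2.2)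
    (hδ'' : δ'' ∈ Ψ.filter fun φ => ∀ ψ ∈ Ψ, ψ ≠ φ → ψ.1 ≠ φ.1 ∧ ψ.2.1 ≠ φ.2.1 ∧ ψ.2.2 ≠ φ.2.2)
    (hmem : (δ.1, δ'.2.1, δ''.2.2) ∈ Ψ) : δ = δ' ∧ δ' = δ'' := by
  simp only [Finset.mem_filter] at hδ hδ' hδ''
  have h1 : (δ.1, δ'.2.1, δ''.2.2) = δ := by
    by_contra h
    exact (hδ.2 _ hmem h).1 rfl
  have h2 : (δ.1, δ'.2.1, δ''.2.2) = δ' := by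
    by_contra h
    exact (hδ'.2 _ hmem h).2.1 rfl
  have h3 : (δ.1, δ'.2.1, δ''.2.2) = δ'' := by
    by_contra h
    exact (hδ''.2 _ hmem h).2.2 rfl
  exact ⟨h1.symm.trans h2, h2.symm.trans h3⟩

/-- **Relative form of BCS Lemma 15.38 (isolated-vertex form), size bound**: for `Ψ* , Ψ` the
elements of `Ψ*` sharing no coordinate with another element of `Ψ` number at least `|Ψ*|` minus the
number of ordered pairs `(φ, ψ) ∈ Ψ* × Ψ`, `φ ≠ ψ`, sharing a coordinate (Le Gall 2014, Lemma A.2: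
a diagonal inside `Λ* ⊆ Λ` which is free in `Λ`). [cite: LeGall2014, Lemma A.2] -/
theorem card_le_card_isolated_add_card_collisions₂ (Ψs Ψ : Finset (I × J × L)) :
    Ψs.card ≤ (Ψs.filter fun φ => ∀ ψ ∈ Ψ, ψ ≠ φ → ψ.1 ≠ φ.1 ∧ ψ.2.1 ≠ φ.2.1 ∧ ψ.2.2 ≠ φ.2.2).card +
      ((Ψs ×ˢ Ψ).filter fun p => p.1 ≠ p.2 ∧
        (p.1.1 = p.2.1 ∨ p.1.2.1 = p.2.2.1 ∨ p.1.2.2 = p.2.2.2)).card := by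
  rw [← Finset.card_filter_add_card_filter_not
    (p := fun φ => ∀ ψ ∈ Ψ, ψ ≠ φ → ψ.1 ≠ φ.1 ∧ ψ.2.1 ≠ φ.2.1 ∧ ψ.2.2 ≠ φ.2.2)]
  refine Nat.add_le_add_left ?_ _
  have hsub : (Ψs.filter fun φ => ¬ ∀ ψ ∈ Ψ, ψ ≠ φ → ψ.1 ≠ φ.1 ∧ ψ.2.1 ≠ φ.2.1 ∧ ψ.2.2 ≠ φ.2.2) ⊆
      ((Ψs ×ˢ Ψ).filter fun p => p.1 ≠ p.2 ∧
        (p.1.1 = p.2.1 ∨ p.1.2.1 = p.2.2.1 ∨ p.1.2.2 = p.2.2.2)).image Prod.fst := by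
    intro φ hφ
    simp only [Finset.mem_filter, not_forall, exists_prop] at hφ
    obtain ⟨hφΨ, ψ, hψΨ, hne, hcoll⟩ := hφ
    refine Finset.mem_image.2 ⟨(φ, ψ), Finset.mem_filter.2 ⟨Finset.mem_product.2 ⟨hφΨ, hψΨ⟩,
      hne.symm, ?_⟩, rfl⟩
    by_contra h
    simp only [not_or] at h
    exact hcoll ⟨Ne.symm h.1, Ne.symm h.2.1, Ne.symm h.2.2⟩
  exact (Finset.card_le_card hsub).trans Finset.card_image_le

/-- **Relative form of BCS Lemma 15.38, diagonal property**: the elements of `Ψ*` isolated in `Ψ`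
form a free diagonal *in `Ψ`*. [cite: BurgisserClausenShokrollahi1997, Lemma 15.38] -/
theorem isolated_free₂ (Ψs Ψ : Finset (I × J × L)) {δ δ' δ'' : I × J × L}
    (hδ : δ ∈ Ψs.filter fun φ => ∀ ψ ∈ Ψ, ψ ≠ φ → ψ.1 ≠ φ.1 ∧ ψ.2.1 ≠ φ.2.1 ∧ ψ.2.2 ≠ φ.2.2)
    (hδ' : δ' ∈ Ψs.filter fun φ => ∀ ψ ∈ Ψ, ψ ≠ φ → ψ.1 ≠ φ.1 ∧ ψ.2.1 ≠ φ.2.1 ∧ ψ.2.2 ≠ φ.2.2)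
    (hδ'' : δ'' ∈ Ψs.filter fun φ => ∀ ψ ∈ Ψ, ψ ≠ φ → ψ.1 ≠ φ.1 ∧ ψ.2.1 ≠ φ.2.1 ∧ ψ.2.2 ≠ φ.2.2)
    (hmem : (δ.1, δ'.2.1, δ''.2.2) ∈ Ψ) : δ = δ' ∧ δ' = δ'' := by
  simp only [Finset.mem_filter] at hδ hδ' hδ''
  have h1 : (δ.1, δ'.2.1, δ''.2.2) = δ := by
    by_contra h
    exact (hδ.2 _ hmem h).1 rfl
  have h2 : (δ.1, δ'.2.1, δ''.2.2) = δ' := by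
    by_contra h
    exact (hδ'.2 _ hmem h).2.1 rfl
  have h3 : (δ.1, δ'.2.1, δ''.2.2) = δ'' := by
    by_contra h
    exact (hδ''.2 _ hmem h).2.2 rfl
  exact ⟨h1.symm.trans h2, h2.symm.trans h3⟩

omit [DecidableEq I] [DecidableEq J] [DecidableEq L] in
/-- A free diagonal in `Ψ ⊆ Φ` is a free diagonal in `Φ` as soon as `Ψ` is "box-closed" in `Φ`
(an element of `Φ` each of whose coordinates occurs in `Ψ` lies in `Ψ`), e.g. `Ψ = ` the elements of
`Φ` whose three hash values lie in prescribed sets. [folklore] -/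
theorem free_of_free_of_boxClosed {Φ Ψ Δ : Finset (I × J × L)} (hΔΨ : Δ ⊆ Ψ)
    (hbox : ∀ φ ∈ Φ, (∃ ψ ∈ Ψ, ψ.1 = φ.1) → (∃ ψ ∈ Ψ, ψ.2.1 = φ.2.1) →
      (∃ ψ ∈ Ψ, ψ.2.2 = φ.2.2) → φ ∈ Ψ)
    (hfree : ∀ δ ∈ Δ, ∀ δ' ∈ Δ, ∀ δ'' ∈ Δ, (δ.1, δ'.2.1, δ''.2.2) ∈ Ψ → δ = δ' ∧ δ' = δ'')
    {δ δ' δ'' : I × J × L} (hδ : δ ∈ Δ) (hδ' : δ' ∈ Δ) (hδ'' : δ'' ∈ Δ)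
    (hmem : (δ.1, δ'.2.1, δ''.2.2) ∈ Φ) : δ = δ' ∧ δ' = δ'' :=
  hfree δ hδ δ' hδ' δ'' hδ'' (hbox _ hmem ⟨δ, hΔΨ hδ, rfl⟩ ⟨δ', hΔΨ hδ', rfl⟩ ⟨δ'', hΔΨ hδ'', rfl⟩)

end Isolated

/-! ## The averaging step (BCS Thm. 15.39, expectation computation) -/

section Averaging

variable {I J L : Type*} [DecidableEq I] [DecidableEq J] [DecidableEq L]

/-- Counting ordered pairs by their first component. [folklore] -/
theorem card_filter_product_eq_sum {α β : Type*} (s : Finset α) (t : Finset β) (p : α × β → Prop)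
    [DecidablePred p] :
    ((s ×ˢ t).filter p).card = ∑ a ∈ s, (t.filter fun b => p (a, b)).card := by
  simp only [Finset.card_filter, Finset.sum_product]

/-- **The averaging step of BCS Thm. 15.39** (p. 378–379), abstract form. Seeds `w` range over a
finite type; `good w φ` says that the block `φ` survives the hashing with seed `w`. If every block
survives for at least `n_D · N₁` seeds, two distinct colliding blocks survive together for at most
`n_D · N₂` seeds, and every block collides with at most `3f` others, then for some seed the number of
surviving blocks minus the number of ordered colliding surviving pairs is at least
`|Φ| · n_D · (N₁ − 3 f N₂) / #seeds`. [cite: BurgisserClausenShokrollahi1997, Thm. 15.39] -/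
theorem exists_seed_of_counts {W : Type*} [Fintype W] [Nonempty W] (Φ : Finset (I × J × L))
    (good : W → I × J × L → Prop) [∀ w φ, Decidable (good w φ)] {nD N₁ N₂ f : ℕ}
    (h1 : ∀ φ ∈ Φ, nD * N₁ ≤ (Finset.univ.filter fun w => good w φ).card)
    (h2 : ∀ φ ∈ Φ, ∀ ψ ∈ Φ, φ ≠ ψ → (φ.1 = ψ.1 ∨ φ.2.1 = ψ.2.1 ∨ φ.2.2 = ψ.2.2) →
      (Finset.univ.filter fun w => good w φ ∧ good w ψ).card ≤ nD * N₂)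
    (h3 : ∀ φ ∈ Φ, (Φ.filter fun ψ => φ ≠ ψ ∧ (φ.1 = ψ.1 ∨ φ.2.1 = ψ.2.1 ∨ φ.2.2 = ψ.2.2)).card
      ≤ 3 * f) :
    ∃ w : W, (Φ.card : ℤ) * nD * ((N₁ : ℤ) - 3 * f * N₂) ≤
      Fintype.card W * (((Φ.filter (good w)).card : ℤ) -
        (((Φ.filter (good w)) ×ˢ (Φ.filter (good w))).filter fun p => p.1 ≠ p.2 ∧
          (p.1.1 = p.2.1 ∨ p.1.2.1 = p.2.2.1 ∨ p.1.2.2 = p.2.2.2)).card) := by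
  classical
  -- (1) total number of survivals
  have hsurv : (Φ.card : ℤ) * nD * N₁ ≤ ∑ w, ((Φ.filter (good w)).card : ℤ) := by
    have : ∑ w, ((Φ.filter (good w)).card : ℤ) =
        ∑ φ ∈ Φ, ((univ.filter fun w => good w φ).card : ℤ) := by
      simp only [Finset.card_filter, Nat.cast_sum]
      rw [Finset.sum_comm]
    rw [this]
    calc (Φ.card : ℤ) * nD * N₁ = ∑ _φ ∈ Φ, ((nD * N₁ : ℕ) : ℤ) := by
          rw [Finset.sum_const, nsmul_eq_mul]; push_cast; ring
      _ ≤ _ := Finset.sum_le_sum fun φ hφ => by exact_mod_cast h1 φ hφ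
  -- (2) total number of ordered colliding surviving pairs
  have hpairs : ∑ w, ((((Φ.filter (good w)) ×ˢ (Φ.filter (good w))).filter fun p => p.1 ≠ p.2 ∧
      (p.1.1 = p.2.1 ∨ p.1.2.1 = p.2.2.1 ∨ p.1.2.2 = p.2.2.2)).card : ℤ) ≤
      (Φ.card : ℤ) * (3 * f) * (nD * N₂) := by
    have e1 : ∀ w, (((Φ.filter (good w)) ×ˢ (Φ.filter (good w))).filter fun p => p.1 ≠ p.2 ∧
        (p.1.1 = p.2.1 ∨ p.1.2.1 = p.2.2.1 ∨ p.1.2.2 = p.2.2.2)) =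
        (((Φ ×ˢ Φ).filter fun p => p.1 ≠ p.2 ∧
          (p.1.1 = p.2.1 ∨ p.1.2.1 = p.2.2.1 ∨ p.1.2.2 = p.2.2.2)).filter
          fun p => good w p.1 ∧ good w p.2) := by
      intro w
      ext p
      simp only [Finset.mem_filter, Finset.mem_product]
      tauto
    simp_rw [e1]
    have e2 : ∑ w, ((((Φ ×ˢ Φ).filter fun p => p.1 ≠ p.2 ∧
          (p.1.1 = p.2.1 ∨ p.1.2.1 = p.2.2.1 ∨ p.1.2.2 = p.2.2.2)).filter
          fun p => good w p.1 ∧ good w p.2).card : ℤ) =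
        ∑ p ∈ (Φ ×ˢ Φ).filter (fun p => p.1 ≠ p.2 ∧
          (p.1.1 = p.2.1 ∨ p.1.2.1 = p.2.2.1 ∨ p.1.2.2 = p.2.2.2)),
          ((univ.filter fun w => good w p.1 ∧ good w p.2).card : ℤ) := by
      simp only [Finset.card_filter, Nat.cast_sum]
      rw [Finset.sum_comm]
    rw [e2]
    have hcnt : ((Φ ×ˢ Φ).filter fun p => p.1 ≠ p.2 ∧
        (p.1.1 = p.2.1 ∨ p.1.2.1 = p.2.2.1 ∨ p.1.2.2 = p.2.2.2)).card ≤ Φ.card * (3 * f) := by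
      rw [card_filter_product_eq_sum]
      calc ∑ a ∈ Φ, (Φ.filter fun b => (a, b).1 ≠ (a, b).2 ∧ ((a, b).1.1 = (a, b).2.1 ∨
            (a, b).1.2.1 = (a, b).2.2.1 ∨ (a, b).1.2.2 = (a, b).2.2.2)).card
          ≤ ∑ _a ∈ Φ, 3 * f := Finset.sum_le_sum fun a ha => h3 a ha
        _ = Φ.card * (3 * f) := by rw [Finset.sum_const, smul_eq_mul]
    calc ∑ p ∈ (Φ ×ˢ Φ).filter (fun p => p.1 ≠ p.2 ∧
          (p.1.1 = p.2.1 ∨ p.1.2.1 = p.2.2.1 ∨ p.1.2.2 = p.2.2.2)),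
          ((univ.filter fun w => good w p.1 ∧ good w p.2).card : ℤ)
        ≤ ∑ p ∈ (Φ ×ˢ Φ).filter (fun p => p.1 ≠ p.2 ∧
          (p.1.1 = p.2.1 ∨ p.1.2.1 = p.2.2.1 ∨ p.1.2.2 = p.2.2.2)), ((nD * N₂ : ℕ) : ℤ) := by
          refine Finset.sum_le_sum fun p hp => ?_
          simp only [Finset.mem_filter, Finset.mem_product] at hp
          exact_mod_cast h2 p.1 hp.1.1 p.2 hp.1.2 hp.2.1 hp.2.2
      _ = (((Φ ×ˢ Φ).filter fun p => p.1 ≠ p.2 ∧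
          (p.1.1 = p.2.1 ∨ p.1.2.1 = p.2.2.1 ∨ p.1.2.2 = p.2.2.2)).card : ℤ) * (nD * N₂) := by
          rw [Finset.sum_const, nsmul_eq_mul]; push_cast; ring
      _ ≤ (Φ.card : ℤ) * (3 * f) * (nD * N₂) := by
          exact_mod_cast Nat.mul_le_mul_right _ hcnt
  -- (3) averaging
  have hsum : ∑ _w : W, (Φ.card : ℤ) * nD * ((N₁ : ℤ) - 3 * f * N₂) ≤
      ∑ w : W, (Fintype.card W : ℤ) * (((Φ.filter (good w)).card : ℤ) -
        ((((Φ.filter (good w)) ×ˢ (Φ.filter (good w))).filter fun p => p.1 ≠ p.2 ∧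
          (p.1.1 = p.2.1 ∨ p.1.2.1 = p.2.2.1 ∨ p.1.2.2 = p.2.2.2)).card : ℤ)) := by
    rw [Finset.sum_const, Finset.card_univ, nsmul_eq_mul, ← Finset.mul_sum, Finset.sum_sub_distrib]
    have : (Φ.card : ℤ) * nD * ((N₁ : ℤ) - 3 * f * N₂) =
        (Φ.card : ℤ) * nD * N₁ - (Φ.card : ℤ) * (3 * f) * (nD * N₂) := by ring
    rw [this]
    exact mul_le_mul_of_nonneg_left (by linarith) (by positivity)
  have hne : (Finset.univ : Finset W).Nonempty := Finset.univ_nonempty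
  obtain ⟨w, _, hw⟩ := Finset.exists_le_of_sum_le hne hsum
  exact ⟨w, hw⟩

/-- **The averaging step, relative form** (Le Gall 2014, Lemma A.2 / the same expectation
computation as BCS Thm. 15.39): the blocks counted are those of `Φ* ⊆ Φ`, the collisions charged are
those of a block of `Φ*` with a block of `Φ`. [cite: BurgisserClausenShokrollahi1997, Thm. 15.39] -/
theorem exists_seed_of_counts₂ {W : Type*} [Fintype W] [Nonempty W] (Φs Φ : Finset (I × J × L))
    (good : W → I × J × L → Prop) [∀ w φ, Decidable (good w φ)] {nD N₁ N₂ f : ℕ}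
    (h1 : ∀ φ ∈ Φs, nD * N₁ ≤ (Finset.univ.filter fun w => good w φ).card)
    (h2 : ∀ φ ∈ Φs, ∀ ψ ∈ Φ, φ ≠ ψ → (φ.1 = ψ.1 ∨ φ.2.1 = ψ.2.1 ∨ φ.2.2 = ψ.2.2) →
      (Finset.univ.filter fun w => good w φ ∧ good w ψ).card ≤ nD * N₂)
    (h3 : ∀ φ ∈ Φs, (Φ.filter fun ψ => φ ≠ ψ ∧ (φ.1 = ψ.1 ∨ φ.2.1 = ψ.2.1 ∨ φ.2.2 = ψ.2.2)).card
      ≤ 3 * f) :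
    ∃ w : W, (Φs.card : ℤ) * nD * ((N₁ : ℤ) - 3 * f * N₂) ≤
      Fintype.card W * (((Φs.filter (good w)).card : ℤ) -
        (((Φs.filter (good w)) ×ˢ (Φ.filter (good w))).filter fun p => p.1 ≠ p.2 ∧
          (p.1.1 = p.2.1 ∨ p.1.2.1 = p.2.2.1 ∨ p.1.2.2 = p.2.2.2)).card) := by
  classical
  -- (1) total number of survivals
  have hsurv : (Φs.card : ℤ) * nD * N₁ ≤ ∑ w, ((Φs.filter (good w)).card : ℤ) := by
    have : ∑ w, ((Φs.filter (good w)).card : ℤ) =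
        ∑ φ ∈ Φs, ((univ.filter fun w => good w φ).card : ℤ) := by
      simp only [Finset.card_filter, Nat.cast_sum]
      rw [Finset.sum_comm]
    rw [this]
    calc (Φs.card : ℤ) * nD * N₁ = ∑ _φ ∈ Φs, ((nD * N₁ : ℕ) : ℤ) := by
          rw [Finset.sum_const, nsmul_eq_mul]; push_cast; ring
      _ ≤ _ := Finset.sum_le_sum fun φ hφ => by exact_mod_cast h1 φ hφ
  -- (2) total number of ordered colliding surviving pairs
  have hpairs : ∑ w, ((((Φs.filter (good w)) ×ˢ (Φ.filter (good w))).filter fun p => p.1 ≠ p.2 ∧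
      (p.1.1 = p.2.1 ∨ p.1.2.1 = p.2.2.1 ∨ p.1.2.2 = p.2.2.2)).card : ℤ) ≤
      (Φs.card : ℤ) * (3 * f) * (nD * N₂) := by
    have e1 : ∀ w, (((Φs.filter (good w)) ×ˢ (Φ.filter (good w))).filter fun p => p.1 ≠ p.2 ∧
        (p.1.1 = p.2.1 ∨ p.1.2.1 = p.2.2.1 ∨ p.1.2.2 = p.2.2.2)) =
        (((Φs ×ˢ Φ).filter fun p => p.1 ≠ p.2 ∧
          (p.1.1 = p.2.1 ∨ p.1.2.1 = p.2.2.1 ∨ p.1.2.2 = p.2.2.2)).filter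
          fun p => good w p.1 ∧ good w p.2) := by
      intro w
      ext p
      simp only [Finset.mem_filter, Finset.mem_product]
      tauto
    simp_rw [e1]
    have e2 : ∑ w, ((((Φs ×ˢ Φ).filter fun p => p.1 ≠ p.2 ∧
          (p.1.1 = p.2.1 ∨ p.1.2.1 = p.2.2.1 ∨ p.1.2.2 = p.2.2.2)).filter
          fun p => good w p.1 ∧ good w p.2).card : ℤ) =
        ∑ p ∈ (Φs ×ˢ Φ).filter (fun p => p.1 ≠ p.2 ∧
          (p.1.1 = p.2.1 ∨ p.1.2.1 = p.2.2.1 ∨ p.1.2.2 = p.2.2.2)),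
          ((univ.filter fun w => good w p.1 ∧ good w p.2).card : ℤ) := by
      simp only [Finset.card_filter, Nat.cast_sum]
      rw [Finset.sum_comm]
    rw [e2]
    have hcnt : ((Φs ×ˢ Φ).filter fun p => p.1 ≠ p.2 ∧
        (p.1.1 = p.2.1 ∨ p.1.2.1 = p.2.2.1 ∨ p.1.2.2 = p.2.2.2)).card ≤ Φs.card * (3 * f) := by
      rw [card_filter_product_eq_sum]
      calc ∑ a ∈ Φs, (Φ.filter fun b => (a, b).1 ≠ (a, b).2 ∧ ((a, b).1.1 = (a, b).2.1 ∨
            (a, b).1.2.1 = (a, b).2.2.1 ∨ (a, b).1.2.2 = (a, b).2.2.2)).card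
          ≤ ∑ _a ∈ Φs, 3 * f := Finset.sum_le_sum fun a ha => h3 a ha
        _ = Φs.card * (3 * f) := by rw [Finset.sum_const, smul_eq_mul]
    calc ∑ p ∈ (Φs ×ˢ Φ).filter (fun p => p.1 ≠ p.2 ∧
          (p.1.1 = p.2.1 ∨ p.1.2.1 = p.2.2.1 ∨ p.1.2.2 = p.2.2.2)),
          ((univ.filter fun w => good w p.1 ∧ good w p.2).card : ℤ)
        ≤ ∑ p ∈ (Φs ×ˢ Φ).filter (fun p => p.1 ≠ p.2 ∧
          (p.1.1 = p.2.1 ∨ p.1.2.1 = p.2.2.1 ∨ p.1.2.2 = p.2.2.2)), ((nD * N₂ : ℕ) : ℤ) := by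
          refine Finset.sum_le_sum fun p hp => ?_
          simp only [Finset.mem_filter, Finset.mem_product] at hp
          exact_mod_cast h2 p.1 hp.1.1 p.2 hp.1.2 hp.2.1 hp.2.2
      _ = (((Φs ×ˢ Φ).filter fun p => p.1 ≠ p.2 ∧
          (p.1.1 = p.2.1 ∨ p.1.2.1 = p.2.2.1 ∨ p.1.2.2 = p.2.2.2)).card : ℤ) * (nD * N₂) := by
          rw [Finset.sum_const, nsmul_eq_mul]; push_cast; ring
      _ ≤ (Φs.card : ℤ) * (3 * f) * (nD * N₂) := by
          exact_mod_cast Nat.mul_le_mul_right _ hcnt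
  -- (3) averaging
  have hsum : ∑ _w : W, (Φs.card : ℤ) * nD * ((N₁ : ℤ) - 3 * f * N₂) ≤
      ∑ w : W, (Fintype.card W : ℤ) * (((Φs.filter (good w)).card : ℤ) -
        ((((Φs.filter (good w)) ×ˢ (Φ.filter (good w))).filter fun p => p.1 ≠ p.2 ∧
          (p.1.1 = p.2.1 ∨ p.1.2.1 = p.2.2.1 ∨ p.1.2.2 = p.2.2.2)).card : ℤ)) := by
    rw [Finset.sum_const, Finset.card_univ, nsmul_eq_mul, ← Finset.mul_sum, Finset.sum_sub_distrib]
    have : (Φs.card : ℤ) * nD * ((N₁ : ℤ) - 3 * f * N₂) =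
        (Φs.card : ℤ) * nD * N₁ - (Φs.card : ℤ) * (3 * f) * (nD * N₂) := by ring
    rw [this]
    exact mul_le_mul_of_nonneg_left (by linarith) (by positivity)
  have hne : (Finset.univ : Finset W).Nonempty := Finset.univ_nonempty
  obtain ⟨w, _, hw⟩ := Finset.exists_le_of_sum_le hne hsum
  exact ⟨w, hw⟩

end Averaging

/-! ## Fibres of surjective homomorphisms (independence of the hash values) -/

section Fibres

/-- Fibres of a surjective homomorphism between finite abelian groups all have cardinality
`|G| / |H|`. [folklore] -/
theorem card_filter_mul_card_eq_card_of_surjective {G H : Type*} [AddCommGroup G] [Fintype G]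
    [AddCommGroup H] [Fintype H] [DecidableEq H] (f : G →+ H) (hf : Function.Surjective f) (y : H) :
    (Finset.univ.filter fun g => f g = y).card * Fintype.card H = Fintype.card G := by
  classical
  have hfib : ∀ y' : H, (univ.filter fun g => f g = y').card = (univ.filter fun g => f g = y).card :=
    fun y' => AddMonoidHom.card_fiber_eq_of_mem_range f (hf y') (hf y)
  have h := Finset.card_eq_sum_card_fiberwise (f := f) (s := (univ : Finset G))
    (t := (univ : Finset H)) (fun _ _ => Finset.mem_univ _)
  rw [Finset.card_univ] at h
  rw [h]
  simp_rw [hfib]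
  rw [Finset.sum_const, Finset.card_univ, smul_eq_mul, mul_comm]

/-- The number of seeds `w = (w₁…w_r, u₁, u₂, u₃) ∈ (ℤ/M)^{r+3}` with prescribed values of the two hash
functions `a·w + u₁ − u₂ = x`, `c·w + u₂ − u₃ = y` is `M^{r+1}` ("`A_w(i)`, `B_w(j)` are uniformly
distributed and independent", BCS p. 378). [cite: BurgisserClausenShokrollahi1997, Thm. 15.39] -/
theorem card_seeds_pair {M : ℕ} [NeZero M] {r : ℕ} (a c : Fin r → ZMod M) (x y : ZMod M) :
    (Finset.univ.filter fun w : (Fin r → ZMod M) × ZMod M × ZMod M × ZMod M =>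
      a ⬝ᵥ w.1 + w.2.1 - w.2.2.1 = x ∧ c ⬝ᵥ w.1 + w.2.2.1 - w.2.2.2 = y).card = M ^ (r + 1) := by
  classical
  -- the hash pair as a homomorphism
  let F : ((Fin r → ZMod M) × ZMod M × ZMod M × ZMod M) →+ ZMod M × ZMod M :=
    { toFun := fun w => (a ⬝ᵥ w.1 + w.2.1 - w.2.2.1, c ⬝ᵥ w.1 + w.2.2.1 - w.2.2.2)
      map_zero' := by simp
      map_add' := fun w w' => by
        simp only [Prod.fst_add, Prod.snd_add, dotProduct_add, Prod.mk_add_mk, Prod.mk.injEq]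
        constructor <;> ring }
  have hF : Function.Surjective F := fun p =>
    ⟨(0, p.1, 0, -p.2), by simp [F]⟩
  have h := card_filter_mul_card_eq_card_of_surjective F hF (x, y)
  have hW : Fintype.card ((Fin r → ZMod M) × ZMod M × ZMod M × ZMod M) = M ^ r * M ^ 3 := by
    simp only [Fintype.card_prod, Fintype.card_fun, ZMod.card, Fintype.card_fin]; ring
  have hH : Fintype.card (ZMod M × ZMod M) = M ^ 2 := by
    simp only [Fintype.card_prod, ZMod.card]; ring
  rw [hW, hH] at h
  have hM : 0 < M ^ 2 := pow_pos (Nat.pos_of_ne_zero (NeZero.ne M)) 2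
  have hcard : (Finset.univ.filter fun w : (Fin r → ZMod M) × ZMod M × ZMod M × ZMod M =>
      F w = (x, y)).card = M ^ (r + 1) := by
    refine Nat.eq_of_mul_eq_mul_right hM ?_
    rw [h]; ring
  rw [← hcard]
  congr 1
  refine Finset.filter_congr fun w _ => ?_
  simp [F, Prod.ext_iff]

/-- The number of seeds with `δ·w = 0` and prescribed values of `a·w + u₁ − u₂`, `c·w + u₂ − u₃` is
`M^r` when `δ` has a coordinate which is a unit of `ℤ/M`, `M` prime ("`A_w(i)`, `A_w(i')`, `C_w(ℓ)`
are independent if `i ≠ i'`: the matrix has rank three", BCS p. 378).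
[cite: BurgisserClausenShokrollahi1997, Thm. 15.39] -/
theorem card_seeds_triple {M : ℕ} [Fact M.Prime] {r : ℕ} (δ a c : Fin r → ZMod M) {ρ₀ : Fin r}
    (hδ : δ ρ₀ ≠ 0) (x y : ZMod M) :
    (Finset.univ.filter fun w : (Fin r → ZMod M) × ZMod M × ZMod M × ZMod M =>
      δ ⬝ᵥ w.1 = 0 ∧ a ⬝ᵥ w.1 + w.2.1 - w.2.2.1 = x ∧ c ⬝ᵥ w.1 + w.2.2.1 - w.2.2.2 = y).card
      = M ^ r := by
  classical
  let F : ((Fin r → ZMod M) × ZMod M × ZMod M × ZMod M) →+ ZMod M × ZMod M × ZMod M :=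
    { toFun := fun w => (δ ⬝ᵥ w.1, a ⬝ᵥ w.1 + w.2.1 - w.2.2.1, c ⬝ᵥ w.1 + w.2.2.1 - w.2.2.2)
      map_zero' := by simp
      map_add' := fun w w' => by
        simp only [Prod.fst_add, Prod.snd_add, dotProduct_add, Prod.mk_add_mk, Prod.mk.injEq]
        refine ⟨trivial, ?_, ?_⟩ <;> ring }
  have hF : Function.Surjective F := by
    rintro ⟨t₁, t₂, t₃⟩
    refine ⟨(Pi.single ρ₀ ((δ ρ₀)⁻¹ * t₁), t₂ - a ⬝ᵥ Pi.single ρ₀ ((δ ρ₀)⁻¹ * t₁), 0,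
      c ⬝ᵥ Pi.single ρ₀ ((δ ρ₀)⁻¹ * t₁) - t₃), ?_⟩
    simp only [F, AddMonoidHom.coe_mk, ZeroHom.coe_mk, Prod.mk.injEq]
    refine ⟨?_, by ring, by ring⟩
    rw [dotProduct_single, ← mul_assoc, mul_inv_cancel₀ hδ, one_mul]
  have h := card_filter_mul_card_eq_card_of_surjective F hF (0, x, y)
  have hW : Fintype.card ((Fin r → ZMod M) × ZMod M × ZMod M × ZMod M) = M ^ r * M ^ 3 := by
    simp only [Fintype.card_prod, Fintype.card_fun, ZMod.card, Fintype.card_fin]; ring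
  have hH : Fintype.card (ZMod M × ZMod M × ZMod M) = M ^ 3 := by
    simp only [Fintype.card_prod, ZMod.card]; ring
  rw [hW, hH] at h
  have hM : 0 < M ^ 3 := pow_pos (Nat.Prime.pos Fact.out) 3
  have hcard : (Finset.univ.filter fun w : (Fin r → ZMod M) × ZMod M × ZMod M × ZMod M =>
      F w = (0, x, y)).card = M ^ r := Nat.eq_of_mul_eq_mul_right hM h
  rw [← hcard]
  congr 1
  refine Finset.filter_congr fun w _ => ?_
  simp [F, Prod.ext_iff]

/-- Two distinct bounded integer vectors differ, modulo a prime `M` exceeding twice the bound, in some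
coordinate by a unit ("as `|α_ρ(i)|, |α_ρ(i')| ≤ b` and `M ≥ 2b+1`, this implied `α_ρ(i) = α_ρ(i')`",
BCS p. 378). [cite: BurgisserClausenShokrollahi1997, Thm. 15.39] -/
theorem exists_coord_cast_sub_ne_zero {M b r : ℕ} [NeZero M] (hbM : 2 * b < M) {v v' : Fin r → ℤ}
    (hv : ∀ ρ, |v ρ| ≤ b) (hv' : ∀ ρ, |v' ρ| ≤ b) (hne : v ≠ v') :
    ∃ ρ₀, ((v ρ₀ : ZMod M) - (v' ρ₀ : ZMod M)) ≠ 0 := by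
  obtain ⟨ρ₀, hρ₀⟩ := Function.ne_iff.1 hne
  refine ⟨ρ₀, fun h => hρ₀ ?_⟩
  rw [← Int.cast_sub, ZMod.intCast_zmod_eq_zero_iff_dvd] at h
  have habs : |v ρ₀ - v' ρ₀| < (M : ℤ) := by
    calc |v ρ₀ - v' ρ₀| ≤ |v ρ₀| + |v' ρ₀| := abs_sub _ _
      _ ≤ b + b := add_le_add (hv ρ₀) (hv' ρ₀)
      _ < M := by exact_mod_cast (by omega : 2 * b < M → b + b < M) hbM
  have := Int.eq_zero_of_abs_lt_dvd h habs
  omega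

/-- **BCS Thm. 15.39, relative form (Le Gall 2014, Lemma A.2)** — large free diagonals inside a
sub-family.  Setting as in `BCS1997_thm1539_free` below (`Φ ⊆ I × J × L` `b`-tight, fibres of the
three projections of `Φ` of size `≤ f`, `M > 2b` prime, `D ⊆ D₁ × D₂ × D₃` a zero-sum diagonal), and
`Φ* ⊆ Φ` any sub-family.  Then there is `Δ ⊆ Φ*` which is a free diagonal IN `Φ` (no block of `Φ`
mixes three members of `Δ` non-trivially, so that zeroing out everything outside `pr₁Δ × pr₂Δ × pr₃Δ`
leaves exactly the blocks `Δ` of `Φ`) with `M³ · |Δ| ≥ |Φ*| · |D| · (M − 3f)`.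
(Le Gall: `Λ* ⊆ Λ`, `Δ ⊆ Λ*` with `|β_ℓ⁻¹(β_ℓ(u,v,w)) ∩ Δ| = 1` for all `(u,v,w) ∈ Δ` and
`|Δ| ≥ c · T N*/N^{1+ε}`; the laser method with values / with compatible distributions takes
`Λ* =` the triples of one joint type inside `Λ =` the triples of given marginal types.)  Same hashing
and expectation argument as the printed theorem, counting survivals of blocks of `Φ*` and charging
every collision of a block of `Φ*` with a block of `Φ`. [cite: LeGall2014, Lemma A.2] -/
theorem BCS1997_thm1539_free_sub {I J L : Type*} [DecidableEq I] [DecidableEq J] [DecidableEq L]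
    (Φ : Finset (I × J × L)) {r b : ℕ} (α : I → Fin r → ℤ) (β : J → Fin r → ℤ)
    (γ : L → Fin r → ℤ) (hα : Function.Injective α) (hβ : Function.Injective β)
    (hγ : Function.Injective γ) (hαb : ∀ i ρ, |α i ρ| ≤ b) (hβb : ∀ j ρ, |β j ρ| ≤ b)
    (htight : ∀ φ ∈ Φ, ∀ ρ, α φ.1 ρ + β φ.2.1 ρ + γ φ.2.2 ρ = 0)
    (Φs : Finset (I × J × L)) (hΦs : Φs ⊆ Φ)
    {f : ℕ} (hfI : ∀ i, (Φ.filter fun φ => φ.1 = i).card ≤ f)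
    (hfJ : ∀ j, (Φ.filter fun φ => φ.2.1 = j).card ≤ f)
    (hfL : ∀ l, (Φ.filter fun φ => φ.2.2 = l).card ≤ f)
    {M : ℕ} (hM : M.Prime) (hbM : 2 * b < M) (D₁ D₂ D₃ : Finset (ZMod M))
    (hD₁ : Set.InjOn (fun d : ZMod M × ZMod M × ZMod M => d.1)
      ↑((D₁ ×ˢ D₂ ×ˢ D₃).filter fun d => d.1 + d.2.1 + d.2.2 = 0))
    (hD₂ : Set.InjOn (fun d : ZMod M × ZMod M × ZMod M => d.2.1)
      ↑((D₁ ×ˢ D₂ ×ˢ D₃).filter fun d => d.1 + d.2.1 + d.2.2 = 0))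
    (hD₃ : Set.InjOn (fun d : ZMod M × ZMod M × ZMod M => d.2.2)
      ↑((D₁ ×ˢ D₂ ×ˢ D₃).filter fun d => d.1 + d.2.1 + d.2.2 = 0)) :
    ∃ Δ : Finset (I × J × L), Δ ⊆ Φs ∧
      (∀ δ ∈ Δ, ∀ δ' ∈ Δ, ∀ δ'' ∈ Δ, (δ.1, δ'.2.1, δ''.2.2) ∈ Φ → δ = δ' ∧ δ' = δ'') ∧
      (Φs.card : ℤ) * ((D₁ ×ˢ D₂ ×ˢ D₃).filter fun d => d.1 + d.2.1 + d.2.2 = 0).card *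
        ((M : ℤ) - 3 * f) ≤ (M : ℤ) ^ 3 * Δ.card := by
  classical
  haveI : Fact M.Prime := ⟨hM⟩
  -- notation
  set D := (D₁ ×ˢ D₂ ×ˢ D₃).filter fun d => d.1 + d.2.1 + d.2.2 = 0 with hD
  let αZ : I → Fin r → ZMod M := fun i ρ => (α i ρ : ZMod M)
  let βZ : J → Fin r → ZMod M := fun j ρ => (β j ρ : ZMod M)
  let γZ : L → Fin r → ZMod M := fun l ρ => (γ l ρ : ZMod M)
  let hA : ((Fin r → ZMod M) × ZMod M × ZMod M × ZMod M) → I → ZMod M :=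
    fun w i => αZ i ⬝ᵥ w.1 + w.2.1 - w.2.2.1
  let hB : ((Fin r → ZMod M) × ZMod M × ZMod M × ZMod M) → J → ZMod M :=
    fun w j => βZ j ⬝ᵥ w.1 + w.2.2.1 - w.2.2.2
  let hC : ((Fin r → ZMod M) × ZMod M × ZMod M × ZMod M) → L → ZMod M :=
    fun w l => γZ l ⬝ᵥ w.1 + w.2.2.2 - w.2.1
  let good : ((Fin r → ZMod M) × ZMod M × ZMod M × ZMod M) → I × J × L → Prop :=
    fun w φ => hA w φ.1 ∈ D₁ ∧ hB w φ.2.1 ∈ D₂ ∧ hC w φ.2.2 ∈ D₃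
  -- tightness modulo `M`: the three hash values of a block of `Φ` sum to zero
  have hsum0 : ∀ φ ∈ Φ, ∀ w, hA w φ.1 + hB w φ.2.1 + hC w φ.2.2 = 0 := by
    intro φ hφ w
    have hvec : αZ φ.1 + βZ φ.2.1 + γZ φ.2.2 = 0 := by
      funext ρ
      simp only [αZ, βZ, γZ, Pi.add_apply, Pi.zero_apply]
      have h := htight φ hφ ρ
      have h' : ((α φ.1 ρ + β φ.2.1 ρ + γ φ.2.2 ρ : ℤ) : ZMod M) = 0 := by rw [h, Int.cast_zero]
      push_cast at h'
      exact h'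
    have : (αZ φ.1 + βZ φ.2.1 + γZ φ.2.2) ⬝ᵥ w.1 = 0 := by rw [hvec, zero_dotProduct]
    simp only [add_dotProduct] at this
    simp only [hA, hB, hC]
    linear_combination this
  -- a block of `Φ` surviving for the seed `w` determines an element of `D`
  have hgoodD : ∀ φ ∈ Φ, ∀ w, good w φ → (hA w φ.1, hB w φ.2.1, hC w φ.2.2) ∈ D := by
    intro φ hφ w hg
    simp only [hD, Finset.mem_filter, Finset.mem_product]
    exact ⟨⟨hg.1, hg.2.1, hg.2.2⟩, hsum0 φ hφ w⟩
  -- (h1) every block of `Φ*` survives for at least `|D| · M^{r+1}` seeds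
  have h1 : ∀ φ ∈ Φs, D.card * M ^ (r + 1) ≤ (Finset.univ.filter fun w => good w φ).card := by
    intro φ hφs
    have hφ : φ ∈ Φ := hΦs hφs
    have hsub : D.biUnion (fun d => Finset.univ.filter fun w =>
        hA w φ.1 = d.1 ∧ hB w φ.2.1 = d.2.1) ⊆ Finset.univ.filter fun w => good w φ := by
      intro w hw
      simp only [Finset.mem_biUnion, Finset.mem_filter, Finset.mem_univ, true_and] at hw
      obtain ⟨d, hd, h1, h2⟩ := hw
      simp only [hD, Finset.mem_filter, Finset.mem_product] at hd
      have h3 : hC w φ.2.2 = d.2.2 := by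
        have := hsum0 φ hφ w
        rw [h1, h2] at this
        linear_combination this - hd.2
      simp only [Finset.mem_filter, Finset.mem_univ, true_and, good]
      exact ⟨h1 ▸ hd.1.1, h2 ▸ hd.1.2.1, h3 ▸ hd.1.2.2⟩
    refine le_trans ?_ (Finset.card_le_card hsub)
    rw [Finset.card_biUnion]
    · simp only [hA, hB, αZ, βZ, card_seeds_pair, Finset.sum_const, smul_eq_mul]; rfl
    · intro d hd d' hd' hne
      simp only [Function.onFun]
      rw [Finset.disjoint_filter]
      intro w _ hw hw'
      exact hne (hD₁ hd hd' (hw.1.symm.trans hw'.1))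
  -- (h2) a block of `Φ*` and a distinct colliding block of `Φ` survive together for at most
  -- `|D| · M^r` seeds
  have h2 : ∀ φ ∈ Φs, ∀ ψ ∈ Φ, φ ≠ ψ → (φ.1 = ψ.1 ∨ φ.2.1 = ψ.2.1 ∨ φ.2.2 = ψ.2.2) →
      (Finset.univ.filter fun w => good w φ ∧ good w ψ).card ≤ D.card * M ^ r := by
    intro φ hφs ψ hψ hne hcoll
    have hφ : φ ∈ Φ := hΦs hφs
    -- tightness: colliding distinct blocks differ in the `I`- or in the `J`-coordinate
    have htφ := htight φ hφ
    have htψ := htight ψ hψ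
    -- a vector `δ'` over `ℤ/M` with a unit coordinate, vanishing on all common seeds
    obtain ⟨δ', ⟨ρ₀, hρ₀⟩, hδ'⟩ : ∃ δ' : Fin r → ZMod M, (∃ ρ₀, δ' ρ₀ ≠ 0) ∧
        ∀ w, good w φ → good w ψ → δ' ⬝ᵥ w.1 = 0 ∧
          ∃ d ∈ D, hA w φ.1 = d.1 ∧ hB w φ.2.1 = d.2.1 := by
      -- the element of `D` hit by `φ` and by `ψ` is the same
      have hsame : ∀ w, good w φ → good w ψ →
          (hA w φ.1, hB w φ.2.1, hC w φ.2.2) = (hA w ψ.1, hB w ψ.2.1, hC w ψ.2.2) := by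
        intro w hgφ hgψ
        have hdφ := hgoodD φ hφ w hgφ
        have hdψ := hgoodD ψ hψ w hgψ
        rcases hcoll with h | h | h
        · exact hD₁ hdφ hdψ (by simp [h])
        · exact hD₂ hdφ hdψ (by simp [h])
        · exact hD₃ hdφ hdψ (by simp [h])
      by_cases hij : φ.2.1 = ψ.2.1
      · -- same `j`: then `i ≠ i'`
        have hii : φ.1 ≠ ψ.1 := by
          intro hii
          apply hne
          have hl : γ φ.2.2 = γ ψ.2.2 := by
            funext ρ; have := htφ ρ; have := htψ ρ; rw [hii, hij] at *; linarith
          exact Prod.ext hii (Prod.ext hij (hγ hl))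
        obtain ⟨ρ₀, hρ₀⟩ := exists_coord_cast_sub_ne_zero (M := M) hbM (hαb φ.1) (hαb ψ.1)
          (fun h => hii (hα h))
        refine ⟨fun ρ => αZ φ.1 ρ - αZ ψ.1 ρ, ⟨ρ₀, hρ₀⟩, fun w hgφ hgψ => ?_⟩
        have hs := hsame w hgφ hgψ
        simp only [Prod.mk.injEq] at hs
        refine ⟨?_, _, hgoodD φ hφ w hgφ, rfl, rfl⟩
        have : hA w φ.1 - hA w ψ.1 = 0 := sub_eq_zero.2 hs.1
        simp only [hA] at this
        rw [show (fun ρ => αZ φ.1 ρ - αZ ψ.1 ρ) = αZ φ.1 - αZ ψ.1 from rfl, sub_dotProduct]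
        linear_combination this
      · -- different `j`
        obtain ⟨ρ₀, hρ₀⟩ := exists_coord_cast_sub_ne_zero (M := M) hbM (hβb φ.2.1) (hβb ψ.2.1)
          (fun h => hij (hβ h))
        refine ⟨fun ρ => βZ φ.2.1 ρ - βZ ψ.2.1 ρ, ⟨ρ₀, hρ₀⟩, fun w hgφ hgψ => ?_⟩
        have hs := hsame w hgφ hgψ
        simp only [Prod.mk.injEq] at hs
        refine ⟨?_, _, hgoodD φ hφ w hgφ, rfl, rfl⟩
        have : hB w φ.2.1 - hB w ψ.2.1 = 0 := sub_eq_zero.2 hs.2.1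
        simp only [hB] at this
        rw [show (fun ρ => βZ φ.2.1 ρ - βZ ψ.2.1 ρ) = βZ φ.2.1 - βZ ψ.2.1 from rfl, sub_dotProduct]
        linear_combination this
    have hsub : (Finset.univ.filter fun w => good w φ ∧ good w ψ) ⊆
        D.biUnion fun d => Finset.univ.filter fun w =>
          δ' ⬝ᵥ w.1 = 0 ∧ hA w φ.1 = d.1 ∧ hB w φ.2.1 = d.2.1 := by
      intro w hw
      simp only [Finset.mem_filter, Finset.mem_univ, true_and] at hw
      obtain ⟨h0, d, hd, hd1, hd2⟩ := hδ' w hw.1 hw.2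
      simp only [Finset.mem_biUnion, Finset.mem_filter, Finset.mem_univ, true_and]
      exact ⟨d, hd, h0, hd1, hd2⟩
    refine (Finset.card_le_card hsub).trans (Finset.card_biUnion_le.trans ?_)
    simp only [hA, hB, αZ, βZ, card_seeds_triple _ _ _ hρ₀, Finset.sum_const, smul_eq_mul]; rfl
  -- (h3) every block collides with at most `3f` blocks of `Φ`
  have h3 : ∀ φ ∈ Φs, (Φ.filter fun ψ => φ ≠ ψ ∧
      (φ.1 = ψ.1 ∨ φ.2.1 = ψ.2.1 ∨ φ.2.2 = ψ.2.2)).card ≤ 3 * f := by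
    intro φ _
    calc (Φ.filter fun ψ => φ ≠ ψ ∧ (φ.1 = ψ.1 ∨ φ.2.1 = ψ.2.1 ∨ φ.2.2 = ψ.2.2)).card
        ≤ ((Φ.filter fun ψ => ψ.1 = φ.1) ∪ (Φ.filter fun ψ => ψ.2.1 = φ.2.1) ∪
            (Φ.filter fun ψ => ψ.2.2 = φ.2.2)).card := by
          refine Finset.card_le_card fun ψ hψ => ?_
          simp only [Finset.mem_filter, Finset.mem_union] at hψ ⊢
          rcases hψ.2.2 with h | h | h
          · exact Or.inl (Or.inl ⟨hψ.1, h.symm⟩)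
          · exact Or.inl (Or.inr ⟨hψ.1, h.symm⟩)
          · exact Or.inr ⟨hψ.1, h.symm⟩
      _ ≤ (Φ.filter fun ψ => ψ.1 = φ.1).card + (Φ.filter fun ψ => ψ.2.1 = φ.2.1).card +
            (Φ.filter fun ψ => ψ.2.2 = φ.2.2).card :=
          (Finset.card_union_le _ _).trans (Nat.add_le_add_right (Finset.card_union_le _ _) _)
      _ ≤ f + f + f := add_le_add (add_le_add (hfI _) (hfJ _)) (hfL _)
      _ = 3 * f := by ring
  -- the averaging step
  obtain ⟨w, hw⟩ := exists_seed_of_counts₂ Φs Φ good h1 h2 h3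
  -- the surviving blocks of `Φ` and of `Φ*`, and the blocks of `Φ*` isolated among those of `Φ`
  set Ψ := Φ.filter (good w) with hΨ
  set Ψs := Φs.filter (good w) with hΨs
  have hΨsΨ : Ψs ⊆ Ψ := Finset.filter_subset_filter _ hΦs
  refine ⟨Ψs.filter fun φ => ∀ ψ ∈ Ψ, ψ ≠ φ → ψ.1 ≠ φ.1 ∧ ψ.2.1 ≠ φ.2.1 ∧ ψ.2.2 ≠ φ.2.2,
    (Finset.filter_subset _ Ψs).trans (Finset.filter_subset _ _), ?_, ?_⟩
  · -- free diagonal in `Φ`: `Ψ` is box-closed in `Φ`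
    intro δ hδ δ' hδ' δ'' hδ'' hmem
    refine free_of_free_of_boxClosed ((Finset.filter_subset _ Ψs).trans hΨsΨ) ?_
      (fun δ hδ δ' hδ' δ'' hδ'' h => isolated_free₂ Ψs Ψ hδ hδ' hδ'' h) hδ hδ' hδ'' hmem
    rintro φ hφ ⟨ψ₁, hψ₁, e₁⟩ ⟨ψ₂, hψ₂, e₂⟩ ⟨ψ₃, hψ₃, e₃⟩
    simp only [hΨ, Finset.mem_filter, good] at hψ₁ hψ₂ hψ₃ ⊢
    exact ⟨hφ, e₁ ▸ hψ₁.2.1, e₂ ▸ hψ₂.2.2.1, e₃ ▸ hψ₃.2.2.2⟩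
  · -- the size bound
    have hiso := card_le_card_isolated_add_card_collisions₂ Ψs Ψ
    have hWcard : (Fintype.card ((Fin r → ZMod M) × ZMod M × ZMod M × ZMod M) : ℤ) =
        (M : ℤ) ^ r * (M : ℤ) ^ 3 := by
      have : Fintype.card ((Fin r → ZMod M) × ZMod M × ZMod M × ZMod M) = M ^ r * M ^ 3 := by
        simp only [Fintype.card_prod, Fintype.card_fun, ZMod.card, Fintype.card_fin]; ring
      rw [this]; push_cast; ring
    rw [hWcard] at hw
    have hMr : (0 : ℤ) < (M : ℤ) ^ r := pow_pos (by exact_mod_cast hM.pos) r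
    refine le_of_mul_le_mul_right ?_ hMr
    have hiso' : ((Ψs.card : ℤ) - (((Ψs ×ˢ Ψ).filter fun p => p.1 ≠ p.2 ∧
        (p.1.1 = p.2.1 ∨ p.1.2.1 = p.2.2.1 ∨ p.1.2.2 = p.2.2.2)).card : ℤ)) ≤
        ((Ψs.filter fun φ => ∀ ψ ∈ Ψ, ψ ≠ φ →
          ψ.1 ≠ φ.1 ∧ ψ.2.1 ≠ φ.2.1 ∧ ψ.2.2 ≠ φ.2.2).card : ℤ) := by
      have := (Int.ofNat_le.2 hiso); push_cast at this; linarith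
    calc (Φs.card : ℤ) * D.card * ((M : ℤ) - 3 * f) * (M : ℤ) ^ r
        = (Φs.card : ℤ) * D.card * (((M ^ (r + 1) : ℕ) : ℤ) - 3 * f * ((M ^ r : ℕ) : ℤ)) := by
          push_cast; ring
      _ ≤ (M : ℤ) ^ r * (M : ℤ) ^ 3 * ((Ψs.card : ℤ) - (((Ψs ×ˢ Ψ).filter fun p => p.1 ≠ p.2 ∧
          (p.1.1 = p.2.1 ∨ p.1.2.1 = p.2.2.1 ∨ p.1.2.2 = p.2.2.2)).card : ℤ)) := hw
      _ ≤ (M : ℤ) ^ r * (M : ℤ) ^ 3 * ((Ψs.filter fun φ => ∀ ψ ∈ Ψ, ψ ≠ φ →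
          ψ.1 ≠ φ.1 ∧ ψ.2.1 ≠ φ.2.1 ∧ ψ.2.2 ≠ φ.2.2).card : ℤ) :=
          mul_le_mul_of_nonneg_left hiso' (by positivity)
      _ = (M : ℤ) ^ 3 * ((Ψs.filter fun φ => ∀ ψ ∈ Ψ, ψ ≠ φ →
          ψ.1 ≠ φ.1 ∧ ψ.2.1 ≠ φ.2.1 ∧ ψ.2.2 ≠ φ.2.2).card : ℤ) * (M : ℤ) ^ r := by ring

/-- **BCS Thm. 15.39 / Bläser 2013 Thm. 9.6 — large free diagonals by hashing (restriction
variant).** Let `Φ ⊆ I × J × L` be `b`-tight: there are injective `α : I → ℤ^r`, `β : J → ℤ^r`,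
`γ : L → ℤ^r`, the entries of `α, β` bounded by `b` in absolute value (no bound on `γ` is needed), and `α(i) + β(j) + γ(ℓ) = 0` for all
`(i,j,ℓ) ∈ Φ`; assume every fibre of the three projections of `Φ` has at most `f` elements; let
`M > 2b` be prime and `D₁, D₂, D₃ ⊆ ℤ/M` be such that
`D = {(x,y,z) ∈ D₁ × D₂ × D₃ | x + y + z = 0}` is a diagonal (its three projections are injective).
Then there is `Δ ⊆ Φ` which is a free diagonal in `Φ` (zeroing out all blocks outside
`pr₁Δ × pr₂Δ × pr₃Δ` leaves exactly the blocks `Δ`, pairwise in distinct rows/columns/slices) with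
`M³ · |Δ| ≥ |Φ| · |D| · (M − 3f)`.
Proof as printed (hash `A_w(i) = Σ α_ρ(i) w_ρ + w_{r+1} − w_{r+2}` etc., average over `w`), with
BCS's degeneration `D ⊴ Ψ_M` (Lemma 15.36) replaced by the sub-diagonal `Ψ_M ∩ (D₁×D₂×D₃)` of
Coppersmith–Winograd's Salem–Spencer construction (CW 1990, §6) so that only zeroing-outs occur, and
Lemma 15.38 in its isolated-vertex form (constant `3` instead of `3/2`).
[cite: BurgisserClausenShokrollahi1997, Thm. 15.39] -/
theorem BCS1997_thm1539_free {I J L : Type*} [DecidableEq I] [DecidableEq J] [DecidableEq L]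
    (Φ : Finset (I × J × L)) {r b : ℕ} (α : I → Fin r → ℤ) (β : J → Fin r → ℤ)
    (γ : L → Fin r → ℤ) (hα : Function.Injective α) (hβ : Function.Injective β)
    (hγ : Function.Injective γ) (hαb : ∀ i ρ, |α i ρ| ≤ b) (hβb : ∀ j ρ, |β j ρ| ≤ b)
    (htight : ∀ φ ∈ Φ, ∀ ρ, α φ.1 ρ + β φ.2.1 ρ + γ φ.2.2 ρ = 0)
    {f : ℕ} (hfI : ∀ i, (Φ.filter fun φ => φ.1 = i).card ≤ f)
    (hfJ : ∀ j, (Φ.filter fun φ => φ.2.1 = j).card ≤ f)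
    (hfL : ∀ l, (Φ.filter fun φ => φ.2.2 = l).card ≤ f)
    {M : ℕ} (hM : M.Prime) (hbM : 2 * b < M) (D₁ D₂ D₃ : Finset (ZMod M))
    (hD₁ : Set.InjOn (fun d : ZMod M × ZMod M × ZMod M => d.1)
      ↑((D₁ ×ˢ D₂ ×ˢ D₃).filter fun d => d.1 + d.2.1 + d.2.2 = 0))
    (hD₂ : Set.InjOn (fun d : ZMod M × ZMod M × ZMod M => d.2.1)
      ↑((D₁ ×ˢ D₂ ×ˢ D₃).filter fun d => d.1 + d.2.1 + d.2.2 = 0))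
    (hD₃ : Set.InjOn (fun d : ZMod M × ZMod M × ZMod M => d.2.2)
      ↑((D₁ ×ˢ D₂ ×ˢ D₃).filter fun d => d.1 + d.2.1 + d.2.2 = 0)) :
    ∃ Δ : Finset (I × J × L), Δ ⊆ Φ ∧
      (∀ δ ∈ Δ, ∀ δ' ∈ Δ, ∀ δ'' ∈ Δ, (δ.1, δ'.2.1, δ''.2.2) ∈ Φ → δ = δ' ∧ δ' = δ'') ∧
      (Φ.card : ℤ) * ((D₁ ×ˢ D₂ ×ˢ D₃).filter fun d => d.1 + d.2.1 + d.2.2 = 0).card *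
        ((M : ℤ) - 3 * f) ≤ (M : ℤ) ^ 3 * Δ.card := by
  obtain ⟨Δ, hΔ, hfree, hsize⟩ := BCS1997_thm1539_free_sub Φ α β γ hα hβ hγ hαb hβb htight Φ
    (Finset.Subset.refl Φ) hfI hfJ hfL hM hbM D₁ D₂ D₃ hD₁ hD₂ hD₃
  exact ⟨Δ, hΔ, hfree, hsize⟩

end Fibres

/-! ## The Salem–Spencer diagonal in `ℤ/M` (replacing BCS Lemma 15.36) -/

section SalemSpencer

/-- **A progression-free set gives a zero-sum diagonal** (Coppersmith–Winograd 1990, §6; the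
device replacing the degeneration of BCS Lemma 15.36 / Bläser Lemma 9.3): if `2k ≤ M` and
`t ⊆ {0,…,k-1}` has no three-term arithmetic progression, then with `D₁ = D₂ = t mod M` and
`D₃ = {-2s}`, the zero-sum triples in `D₁ × D₂ × D₃` are exactly the `(s, s, -2s)`, a diagonal;
hence `ℤ/M` carries such a diagonal of size `≥ rothNumberNat k`.
[cite: CoppersmithWinograd1990, §6] -/
theorem exists_zeroSum_diagonal (M k : ℕ) [NeZero M] (hk : 2 * k ≤ M) :
    ∃ D₁ D₂ D₃ : Finset (ZMod M),
      Set.InjOn (fun d : ZMod M × ZMod M × ZMod M => d.1)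
        ↑((D₁ ×ˢ D₂ ×ˢ D₃).filter fun d => d.1 + d.2.1 + d.2.2 = 0) ∧
      Set.InjOn (fun d : ZMod M × ZMod M × ZMod M => d.2.1)
        ↑((D₁ ×ˢ D₂ ×ˢ D₃).filter fun d => d.1 + d.2.1 + d.2.2 = 0) ∧
      Set.InjOn (fun d : ZMod M × ZMod M × ZMod M => d.2.2)
        ↑((D₁ ×ˢ D₂ ×ˢ D₃).filter fun d => d.1 + d.2.1 + d.2.2 = 0) ∧
      rothNumberNat k ≤ ((D₁ ×ˢ D₂ ×ˢ D₃).filter fun d => d.1 + d.2.1 + d.2.2 = 0).card := by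
  classical
  obtain ⟨t, htk, htcard, hfree⟩ := rothNumberNat_spec k
  have htlt : ∀ a ∈ t, a < k := fun a ha => Finset.mem_range.1 (htk ha)
  -- casting naturals `< M` is injective, and sums of two elements of `t` do not wrap around
  have hcast : ∀ a b : ℕ, a < M → b < M → ((a : ZMod M) = b ↔ a = b) := fun a b ha hb => by
    rw [ZMod.natCast_eq_natCast_iff', Nat.mod_eq_of_lt ha, Nat.mod_eq_of_lt hb]
  have hsum : ∀ a ∈ t, ∀ b ∈ t, ∀ a' ∈ t, ∀ b' ∈ t,
      (a : ZMod M) + b = (a' : ZMod M) + b' → a + b = a' + b' := by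
    intro a ha b hb a' ha' b' hb' h
    have h1 : a + b < M := by have := htlt a ha; have := htlt b hb; omega
    have h2 : a' + b' < M := by have := htlt a' ha'; have := htlt b' hb'; omega
    rw [← Nat.cast_add, ← Nat.cast_add, hcast _ _ h1 h2] at h
    exact h
  let S : Finset (ZMod M) := t.image (Nat.cast : ℕ → ZMod M)
  refine ⟨S, S, S.image fun y => -(y + y), ?_⟩
  set D := (S ×ˢ S ×ˢ S.image fun y => -(y + y)).filter fun d => d.1 + d.2.1 + d.2.2 = 0 with hD
  -- structure of the zero-sum triples: `(s, s, -2s)`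
  have hstruct : ∀ d ∈ D, ∃ a ∈ t, d = ((a : ZMod M), (a : ZMod M), -((a : ZMod M) + a)) := by
    intro d hd
    simp only [hD, Finset.mem_filter, Finset.mem_product, Finset.mem_image, S] at hd
    obtain ⟨⟨⟨a, ha, hax⟩, ⟨c, hc, hcy⟩, ⟨w, ⟨b, hb, hbw⟩, hwz⟩⟩, h0⟩ := hd
    have hac : (a : ZMod M) + c = b + b := by
      rw [hax, hcy, hbw]; rw [← hwz] at h0; linear_combination h0
    have habc := hsum a ha c hc b hb b hb hac
    have hab : a = b := hfree ha hb hc habc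
    subst hab
    have hcb : c = a := by omega
    subst hcb
    refine ⟨c, hc, ?_⟩
    ext <;> simp [← hax, ← hcy, ← hwz, ← hbw]
  refine ⟨?_, ?_, ?_, ?_⟩
  · intro d hd d' hd' h
    obtain ⟨a, ha, rfl⟩ := hstruct d hd
    obtain ⟨a', ha', rfl⟩ := hstruct d' hd'
    simp only at h
    simp [h]
  · intro d hd d' hd' h
    obtain ⟨a, ha, rfl⟩ := hstruct d hd
    obtain ⟨a', ha', rfl⟩ := hstruct d' hd'
    simp only at h
    simp [h]
  · intro d hd d' hd' h
    obtain ⟨a, ha, rfl⟩ := hstruct d hd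
    obtain ⟨a', ha', rfl⟩ := hstruct d' hd'
    simp only [neg_inj] at h
    have := hsum a ha a ha a' ha' a' ha' h
    have haa : a = a' := by omega
    simp [haa]
  · -- size: the triples `(a, a, -2a)`, `a ∈ t`, are distinct elements of `D`
    rw [← htcard]
    refine Finset.card_le_card_of_injOn (fun a : ℕ => ((a : ZMod M), (a : ZMod M),
      -((a : ZMod M) + a))) (fun a ha => ?_) ?_
    · simp only [hD, Finset.mem_coe, Finset.mem_filter, Finset.mem_product, Finset.mem_image, S]
      exact ⟨⟨⟨a, ha, rfl⟩, ⟨a, ha, rfl⟩, ⟨a, ⟨a, ha, rfl⟩, rfl⟩⟩, by ring⟩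
    · intro a ha a' ha' h
      simp only [Prod.mk.injEq] at h
      have hlt : ∀ x ∈ t, x < M := fun x hx => by have := htlt x hx; omega
      exact (hcast a a' (hlt a ha) (hlt a' ha')).1 h.1

end SalemSpencer

end Literature.Computability.AlgebraicComplexity
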